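import Summits.FinalStateConjecture.FinalStateConjecture.Theses.KerrnessPropagates

/-!
# Route `KerrnessPropagates`, crux `KerrBasinCapture` (stmt-FinalStateConjecture-17646) — DEFINITIONS posited by the
# line `registered` (skeleton `Cruxes/KerrBasinCapture/Lines/birth.lean`)

The crux `KerrBasinCapture` of the route file `Theses/KerrnessPropagates.lean` is ONE monolithic `Prop`; its inner
block — the ONE-CHART HAND-OVER SLAB of a vacuum Cauchy development at lab time `τ`, accuracy `ε`, for a multi-Kerr
configuration `(N; Mᵢ, aᵢ, r₀ᵢ; (Λᵢ, cᵢ))` — recurs verbatim in every stub of the line's reduction skeleton, and the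
gate caps registered stub signatures at 4000 characters. This file therefore NAMES the recurring objects of the line
(no new mathematics; every definition is the verbatim text of the route file / the skeleton, so that the skeleton's
consistency checks remain `Iff.rfl`):

* `SlabWith k 𝒟 N M a r₀ mo ε τ R U Φ` — the hand-over slab for GIVEN near-zone radii `R`, chart domain `U` and chart
  `Φ` (the body of the crux's inner `∃ R U Φ, …`): `Rᵢ ≥ r₀ᵢ + 1`, `Φ` a smooth open embedding, `U ⊇ {x⁰ = τ} ∖ inner
  discs`, image in `J⁺(ιΣ)`, achronal slab image, `ε`-Kerrᵢ in `Cᵏ` (sup) on the near discs `{r₀ᵢ < rᵢ ≤ Rᵢ}`,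
  `ε`-flat on the far zone `{∀ j, rⱼ ≥ Rⱼ − 1}`, and `Φ_*∂₀` future-directed there;
* `SlabAt k 𝒟 N M a r₀ mo ε τ := ∃ R U Φ, SlabWith …` — verbatim the crux's recurrence block at `(ε, τ)`;
* `InMargins N₀ m₀ χ μ v₀ L₀ N M a r₀ mo` — the MARGIN FAMILY of `stub_tameOmegaCapture`: `N ≤ N₀`, masses in
  `[m₀, m₀⁻¹]`, `|aᵢ| ≤ χ Mᵢ`, inner radii `μ`-inside `(r₋, r₊)`, boosts of pointwise norm `≤ L₀`, pairwise lab
  velocities `≥ v₀` apart;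
* `labPos Λ c τ` — the lab position at lab time `τ` of the straight worldline of the motion `(Λ, c)`,
  `c̲ + (τ − c⁰) (Λe₀)̲/(Λe₀)⁰`;
* `shearFrame Λn Λl` — the canonical frame map `(I + e₀ ⊗ κ⁻¹(λₗ − λₙ)) ∘ Λₗ⁻¹` (`λ = dx⁰ ∘ Λ`, `κ = (Λₙ e₀)⁰`) of the
  per-hole affine re-gauging used by `stub_reanchorMapShear`.

Each definition comes with its `Iff.rfl` / `rfl` unfolding lemma. Sources: the route file (planner, 2026-08-16); the
line's skeleton (lead, 2026-08-17); DHRT arXiv:2104.08222 §1 for the `Cᵏ` sup-norm deviation language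
(`Literature.Geometry.Lorentzian.supCkENorm`, `Spacetime.deviationExtend`).
-/

open scoped BigOperators Topology Manifold Classical Matrix InnerProductSpace ContinuousMap
open Filter Set Function TopologicalSpace
open Literature.Geometry.Lorentzian

-- D-0017: single-problem summit, `Summit.<S>.<S>.…` by design.
set_option linter.dupNamespace false

noncomputable section

namespace Summit.FinalStateConjecture.FinalStateConjecture.Theorems.KerrnessPropagates.KerrBasinCapture

section Slab

variable {X : Type} [TopologicalSpace X] [ChartedSpace E3 X] [IsManifold (𝓡 3) (⊤ : ℕ∞) X] [ConnectedSpace X]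
  {D : InitialDataSet (𝓡 3) X}

/-- The ONE-CHART HAND-OVER SLAB of the vacuum Cauchy development `𝒟` at lab time `τ` and accuracy `ε`, for the
`N`-hole configuration `(M, a, r₀; mo)` (`mo i = (Λᵢ, cᵢ)`), with GIVEN near-zone radii `R`, chart domain `U` and chart
`Φ : U → 𝒟`: `Rᵢ ≥ r₀ᵢ + 1`; `Φ` smooth and an open embedding; `U ⊇ {x⁰ = τ} ∖ ⋃ᵢ {rᵢ ≤ r₀ᵢ}`; `range Φ ⊆ J⁺(ιΣ)`;
the slab image `Φ(U ∩ {x⁰ = τ})` achronal; on each near disc `{x⁰ = τ, ∀ j r₀ⱼ < rⱼ, rᵢ ≤ Rᵢ}` the `Cᵏ` sup norm of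
the deviation of `Φ^*g` from boosted Kerr–Schild Kerrᵢ is `≤ ε`; on the far zone `{x⁰ = τ, ∀ j r₀ⱼ < rⱼ, ∀ j rⱼ ≥ Rⱼ−1}`
the deviation from `η` is `≤ ε`; and `Φ_*∂₀` is future-directed on `U ∩ {x⁰ = τ, ∀ j rⱼ ≥ Rⱼ − 1}`. Verbatim the body
of the inner existential of the route decl `KerrnessPropagates.KerrBasinCapture`. -/
def SlabWith (k : ℕ) (𝒟 : VacuumCauchyDevelopment D) (N : ℕ) (M a r₀ : Fin N → ℝ)
    (mo : Fin N → ↥lorentzGroup × E4) (ε τ : ℝ) (R : Fin N → ℝ) (U : Opens E4) (Φ : U → 𝒟.carrier) : Prop :=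
  (∀ i, r₀ i + 1 ≤ R i) ∧ ContMDiff 𝓘(ℝ, E4) (𝓡 4) (⊤ : ℕ∞) Φ ∧ Topology.IsOpenEmbedding Φ ∧ {x : E4 | x 0 = τ ∧ (∀ j, r₀ j < Kerr.radius (a j) (poincareInv (mo j).1 (mo j).2 x))} ⊆ (U : Set E4) ∧ range Φ ⊆ 𝒟.metric.causalFuture 𝒟.timeOrientation (range 𝒟.embed) ∧ 𝒟.metric.IsAchronal 𝒟.timeOrientation (Φ '' {x : ↥U | (x : E4) 0 = τ}) ∧ (∀ i, supCkENorm {x : E4 | x 0 = τ ∧ (∀ j, r₀ j < Kerr.radius (a j) (poincareInv (mo j).1 (mo j).2 x)) ∧ Kerr.radius (a i) (poincareInv (mo i).1 (mo i).2 x) ≤ R i} k (𝒟.toSpacetime.deviationExtend ⟨U, boostedKerrBilin (mo i).1 (mo i).2 (M i) (a i), fun x ↦ x 0, fun x ↦ Kerr.radius (a i) (poincareInv (mo i).1 (mo i).2 x)⟩ Φ) ≤ ENNReal.ofReal ε) ∧ supCkENorm {x : E4 | x 0 = τ ∧ (∀ j, r₀ j < Kerr.radius (a j) (poincareInv (mo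 j).1 (mo j).2 x)) ∧ ∀ j, R j - 1 ≤ Kerr.radius (a j) (poincareInv (mo j).1 (mo j).2 x)} k (𝒟.toSpacetime.deviationExtend (Minkowski.backgroundOn U) Φ) ≤ ENNReal.ofReal ε ∧ (∀ x : ↥U, x.1 0 = τ → (∀ j, R j - 1 ≤ Kerr.radius (a j) (poincareInv (mo j).1 (mo j).2 x.1)) → 𝒟.timeOrientation.IsFutureDirected (mfderiv 𝓘(ℝ, E4) (𝓡 4) Φ x (E4.basisVector 0)))

/-- The hand-over slab at `(ε, τ)` for the configuration `(N; M, a, r₀; mo)`: SOME radii, domain and chart do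
(`∃ R U Φ, SlabWith …`); verbatim the recurrence block of `KerrnessPropagates.KerrBasinCapture`. -/
def SlabAt (k : ℕ) (𝒟 : VacuumCauchyDevelopment D) (N : ℕ) (M a r₀ : Fin N → ℝ)
    (mo : Fin N → ↥lorentzGroup × E4) (ε τ : ℝ) : Prop :=
  ∃ (R : Fin N → ℝ) (U : Opens E4) (Φ : U → 𝒟.carrier), SlabWith k 𝒟 N M a r₀ mo ε τ R U Φ

/-- Unfolding `SlabWith` (definitional). -/
theorem slabWith_iff (k : ℕ) (𝒟 : VacuumCauchyDevelopment D) (N : ℕ) (M a r₀ : Fin N → ℝ)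
    (mo : Fin N → ↥lorentzGroup × E4) (ε τ : ℝ) (R : Fin N → ℝ) (U : Opens E4) (Φ : U → 𝒟.carrier) :
    SlabWith k 𝒟 N M a r₀ mo ε τ R U Φ ↔ (∀ i, r₀ i + 1 ≤ R i) ∧ ContMDiff 𝓘(ℝ, E4) (𝓡 4) (⊤ : ℕ∞) Φ ∧ Topology.IsOpenEmbedding Φ ∧ {x : E4 | x 0 = τ ∧ (∀ j, r₀ j < Kerr.radius (a j) (poincareInv (mo j).1 (mo j).2 x))} ⊆ (U : Set E4) ∧ range Φ ⊆ 𝒟.metric.causalFuture 𝒟.timeOrientation (range 𝒟.embed) ∧ 𝒟.metric.IsAchronal 𝒟.timeOrientation (Φ '' {x : ↥U | (x : E4) 0 = τ}) ∧ (∀ i, supCkENorm {x : E4 | x 0 = τ ∧ (∀ j, r₀ j < Kerr.radius (a j) (poincareInv (mo j).1 (mo j).2 x)) ∧ Kerr.radius (a i) (poincareInv (mo i).1 (mo i).2 x) ≤ R i} k (𝒟.toSpacetime.deviationExtend ⟨U, boostedKerrBilin (mo i).1 (mo i).2 (M i) (a i), fun x ↦ x 0, fun x ↦ Kerr.radius (a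 i) (poincareInv (mo i).1 (mo i).2 x)⟩ Φ) ≤ ENNReal.ofReal ε) ∧ supCkENorm {x : E4 | x 0 = τ ∧ (∀ j, r₀ j < Kerr.radius (a j) (poincareInv (mo j).1 (mo j).2 x)) ∧ ∀ j, R j - 1 ≤ Kerr.radius (a j) (poincareInv (mo j).1 (mo j).2 x)} k (𝒟.toSpacetime.deviationExtend (Minkowski.backgroundOn U) Φ) ≤ ENNReal.ofReal ε ∧ (∀ x : ↥U, x.1 0 = τ → (∀ j, R j - 1 ≤ Kerr.radius (a j) (poincareInv (mo j).1 (mo j).2 x.1)) → 𝒟.timeOrientation.IsFutureDirected (mfderiv 𝓘(ℝ, E4) (𝓡 4) Φ x (E4.basisVector 0))) :=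
  Iff.rfl

/-- Unfolding `SlabAt` (definitional). -/
theorem slabAt_iff (k : ℕ) (𝒟 : VacuumCauchyDevelopment D) (N : ℕ) (M a r₀ : Fin N → ℝ)
    (mo : Fin N → ↥lorentzGroup × E4) (ε τ : ℝ) :
    SlabAt k 𝒟 N M a r₀ mo ε τ ↔
      ∃ (R : Fin N → ℝ) (U : Opens E4) (Φ : U → 𝒟.carrier), SlabWith k 𝒟 N M a r₀ mo ε τ R U Φ :=
  Iff.rfl

/-- `SlabWith` is monotone in the accuracy. -/
theorem SlabWith.mono {k : ℕ} {𝒟 : VacuumCauchyDevelopment D} {N : ℕ} {M a r₀ : Fin N → ℝ}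
    {mo : Fin N → ↥lorentzGroup × E4} {ε ε' τ : ℝ} {R : Fin N → ℝ} {U : Opens E4} {Φ : U → 𝒟.carrier}
    (h : SlabWith k 𝒟 N M a r₀ mo ε τ R U Φ) (hε : ε ≤ ε') : SlabWith k 𝒟 N M a r₀ mo ε' τ R U Φ := by
  obtain ⟨h1, h2, h3, h4, h5, h6, h7, h8, h9⟩ := h
  exact ⟨h1, h2, h3, h4, h5, h6, fun i ↦ (h7 i).trans (ENNReal.ofReal_le_ofReal hε),
    h8.trans (ENNReal.ofReal_le_ofReal hε), h9⟩

/-- `SlabAt` is monotone in the accuracy. -/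
theorem SlabAt.mono {k : ℕ} {𝒟 : VacuumCauchyDevelopment D} {N : ℕ} {M a r₀ : Fin N → ℝ}
    {mo : Fin N → ↥lorentzGroup × E4} {ε ε' τ : ℝ} (h : SlabAt k 𝒟 N M a r₀ mo ε τ) (hε : ε ≤ ε') :
    SlabAt k 𝒟 N M a r₀ mo ε' τ := by
  obtain ⟨R, U, Φ, h⟩ := h
  exact ⟨R, U, Φ, h.mono hε⟩

end Slab

/-- The MARGIN FAMILY `(N₀, m₀, χ, μ, v₀, L₀)` of multi-Kerr configurations: at most `N₀` holes, masses in
`[m₀, m₀⁻¹]`, uniformly sub-extremal spins `|aᵢ| ≤ χ Mᵢ`, inner radii `μ`-inside `(r₋, r₊)`, boosts of pointwise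
operator norm `≤ L₀`, and STRICT RECESSION: pairwise lab velocities `(Λᵢe₀)̲/(Λᵢe₀)⁰` at distance `≥ v₀`. Verbatim the
margins of the skeleton's `stub_tameOmegaCapture`. -/
def InMargins (N₀ : ℕ) (m₀ χ μ v₀ L₀ : ℝ) (N : ℕ) (M a r₀ : Fin N → ℝ)
    (mo : Fin N → ↥lorentzGroup × E4) : Prop :=
  N ≤ N₀ ∧ (∀ i, m₀ ≤ M i ∧ M i ≤ m₀⁻¹ ∧ |a i| ≤ χ * M i ∧ Kerr.rMinus (M i) (a i) + μ ≤ r₀ i ∧ r₀ i + μ ≤ Kerr.rPlus (M i) (a i) ∧ ∀ v : E4, ‖((mo i).1 : E4 ≃L[ℝ] E4) v‖ ≤ L₀ * ‖v‖) ∧ (∀ i j, i ≠ j → v₀ ≤ ‖(((mo i).1 : E4 ≃L[ℝ] E4) (E4.basisVector 0) 0)⁻¹ • E4.spatial (((mo i).1 : E4 ≃L[ℝ] E4) (E4.basisVector 0)) - (((mo j).1 : E4 ≃L[ℝ] E4) (E4.basisVector 0) 0)⁻¹ • E4.spatial (((mo j).1 : E4 ≃L[ℝ] E4) (E4.basisVector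 0))‖)

/-- Unfolding `InMargins` (definitional). -/
theorem inMargins_iff (N₀ : ℕ) (m₀ χ μ v₀ L₀ : ℝ) (N : ℕ) (M a r₀ : Fin N → ℝ)
    (mo : Fin N → ↥lorentzGroup × E4) :
    InMargins N₀ m₀ χ μ v₀ L₀ N M a r₀ mo ↔ N ≤ N₀ ∧ (∀ i, m₀ ≤ M i ∧ M i ≤ m₀⁻¹ ∧ |a i| ≤ χ * M i ∧ Kerr.rMinus (M i) (a i) + μ ≤ r₀ i ∧ r₀ i + μ ≤ Kerr.rPlus (M i) (a i) ∧ ∀ v : E4, ‖((mo i).1 : E4 ≃L[ℝ] E4) v‖ ≤ L₀ * ‖v‖) ∧ (∀ i j, i ≠ j → v₀ ≤ ‖(((mo i).1 : E4 ≃L[ℝ] E4) (E4.basisVector 0) 0)⁻¹ • E4.spatial (((mo i).1 : E4 ≃L[ℝ] E4) (E4.basisVector 0)) - (((mo j).1 : E4 ≃L[ℝ] E4) (E4.basisVector 0) 0)⁻¹ • E4.spatial (((mo j).1 : E4 ≃L[ℝ] E4) (E4.basisVector 0))‖) :=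
  Iff.rfl

/-- The LAB POSITION at lab time `τ` of the straight worldline `s ↦ Λ (s e₀) + c` of the motion `(Λ, c)`:
`c̲ + (τ − c⁰) · V` with lab velocity `V = (Λ e₀)̲ / (Λ e₀)⁰` (the spatial part of the worldline point whose time
coordinate is `τ`). -/
def labPos (Λ : ↥lorentzGroup) (c : E4) (τ : ℝ) : E3 :=
  E4.spatial c + (τ - c 0) • ((((Λ : E4 ≃L[ℝ] E4) (E4.basisVector 0)) 0)⁻¹ •
    E4.spatial ((Λ : E4 ≃L[ℝ] E4) (E4.basisVector 0)))

/-- Unfolding `labPos` (definitional). -/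
theorem labPos_def (Λ : ↥lorentzGroup) (c : E4) (τ : ℝ) :
    labPos Λ c τ = E4.spatial c + (τ - c 0) • ((((Λ : E4 ≃L[ℝ] E4) (E4.basisVector 0)) 0)⁻¹ •
      E4.spatial ((Λ : E4 ≃L[ℝ] E4) (E4.basisVector 0))) :=
  rfl

/-- The CANONICAL SHEAR FRAME MAP of the per-hole affine re-gauging `Θ = Pₙ ∘ S ∘ Pₗ⁻¹` (a rest-frame time shear `S`
chosen so that `Θ` preserves lab time): `(I + e₀ ⊗ κ⁻¹ (λₗ − λₙ)) ∘ Λₗ⁻¹` with `λ = dx⁰ ∘ Λ` and `κ = (Λₙ e₀)⁰`; it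
maps `Λₗ e₀` into `ℝ e₀`, tends to `Λₗ⁻¹` as `Λₙ → Λₗ`, and `shearFrame Λn Λl v` has the same spatial part as `Λₗ⁻¹ v`.
This is the frame map `T` of `stub_reanchorMapShear` (spelled out there). -/
def shearFrame (Λn Λl : ↥lorentzGroup) : E4 →L[ℝ] E4 :=
  ((ContinuousLinearMap.id ℝ E4 + ((((Λn : E4 ≃L[ℝ] E4) (E4.basisVector 0)) 0)⁻¹ • ((E4.dx 0).comp ((Λl : E4 ≃L[ℝ] E4) : E4 →L[ℝ] E4) - (E4.dx 0).comp ((Λn : E4 ≃L[ℝ] E4) : E4 →L[ℝ] E4))).smulRight (E4.basisVector 0)).comp ((Λl : E4 ≃L[ℝ] E4).symm : E4 →L[ℝ] E4))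

/-- Unfolding `shearFrame` (definitional). -/
theorem shearFrame_def (Λn Λl : ↥lorentzGroup) :
    shearFrame Λn Λl = ((ContinuousLinearMap.id ℝ E4 + ((((Λn : E4 ≃L[ℝ] E4) (E4.basisVector 0)) 0)⁻¹ • ((E4.dx 0).comp ((Λl : E4 ≃L[ℝ] E4) : E4 →L[ℝ] E4) - (E4.dx 0).comp ((Λn : E4 ≃L[ℝ] E4) : E4 →L[ℝ] E4))).smulRight (E4.basisVector 0)).comp ((Λl : E4 ≃L[ℝ] E4).symm : E4 →L[ℝ] E4)) :=
  rfl

/-- stub (anchor) — ACCURACY MONOTONICITY OF THE HAND-OVER SLAB (registered stub of crux stmt-FinalStateConjecture-17646,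
line `registered`): `SlabAt … ε τ → SlabAt … ε' τ` for `ε ≤ ε'`, stated expanded (it is `SlabAt.mono` through
`slabAt_iff`, definitionally). Used in the `N = 0` case of the slab transfer. -/
theorem stub_slabAtMono : ∀ k : ℕ, ∀ (X : Type) [TopologicalSpace X] [ChartedSpace E3 X] [IsManifold (𝓡 3) (⊤ : ℕ∞) X] [T2Space X] [SecondCountableTopology X] [ConnectedSpace X] (D : InitialDataSet (𝓡 3) X) (𝒟 : VacuumCauchyDevelopment D) (N : ℕ) (M a r₀ : Fin N → ℝ) (mo : Fin N → ↥lorentzGroup × E4) (ε ε' τ : ℝ), ε ≤ ε' → (∃ (R : Fin N → ℝ) (U : Opens E4) (Φ : U → 𝒟.carrier), (∀ i, r₀ i + 1 ≤ R i) ∧ ContMDiff 𝓘(ℝ, E4) (𝓡 4) (⊤ : ℕ∞) Φ ∧ Topology.IsOpenEmbedding Φ ∧ {x : E4 | x 0 = τ ∧ (∀ j, r₀ j < Kerr.radius (a j) (poincareInv (mo j).1 (mo j).2 x))} ⊆ (U : Set E4) ∧ range Φ ⊆ 𝒟.metric.causalFuture 𝒟.timeOrientation (range 𝒟.embed) ∧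 𝒟.metric.IsAchronal 𝒟.timeOrientation (Φ '' {x : ↥U | (x : E4) 0 = τ}) ∧ (∀ i, supCkENorm {x : E4 | x 0 = τ ∧ (∀ j, r₀ j < Kerr.radius (a j) (poincareInv (mo j).1 (mo j).2 x)) ∧ Kerr.radius (a i) (poincareInv (mo i).1 (mo i).2 x) ≤ R i} k (𝒟.toSpacetime.deviationExtend ⟨U, boostedKerrBilin (mo i).1 (mo i).2 (M i) (a i), fun x ↦ x 0, fun x ↦ Kerr.radius (a i) (poincareInv (mo i).1 (mo i).2 x)⟩ Φ) ≤ ENNReal.ofReal ε) ∧ supCkENorm {x : E4 | x 0 = τ ∧ (∀ j, r₀ j < Kerr.radius (a j) (poincareInv (mo j).1 (mo j).2 x)) ∧ ∀ j, R j - 1 ≤ Kerr.radius (a j) (poincareInv (mo j).1 (mo j).2 x)} k (𝒟.toSpacetime.deviationExtend (Minkowski.backgroundOn U) Φ) ≤ ENNReal.ofReal ε ∧ (∀ x : ↥U, x.1 0 = τ → (∀ j, R j - 1 ≤ Kerr.radius (a j) (poincareInv (mo j).1 (mo j).2 x.1)) → 𝒟.timeOrientation.IsFutureDirected (mfderiv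 𝓘(ℝ, E4) (𝓡 4) Φ x (E4.basisVector 0)))) → ∃ (R : Fin N → ℝ) (U : Opens E4) (Φ : U → 𝒟.carrier), (∀ i, r₀ i + 1 ≤ R i) ∧ ContMDiff 𝓘(ℝ, E4) (𝓡 4) (⊤ : ℕ∞) Φ ∧ Topology.IsOpenEmbedding Φ ∧ {x : E4 | x 0 = τ ∧ (∀ j, r₀ j < Kerr.radius (a j) (poincareInv (mo j).1 (mo j).2 x))} ⊆ (U : Set E4) ∧ range Φ ⊆ 𝒟.metric.causalFuture 𝒟.timeOrientation (range 𝒟.embed) ∧ 𝒟.metric.IsAchronal 𝒟.timeOrientation (Φ '' {x : ↥U | (x : E4) 0 = τ}) ∧ (∀ i, supCkENorm {x : E4 | x 0 = τ ∧ (∀ j, r₀ j < Kerr.radius (a j) (poincareInv (mo j).1 (mo j).2 x)) ∧ Kerr.radius (a i) (poincareInv (mo i).1 (mo i).2 x) ≤ R i} k (𝒟.toSpacetime.deviationExtend ⟨U, boostedKerrBilin (mo i).1 (mo i).2 (M i) (a i), fun x ↦ x 0, fun x ↦ Kerr.radius (a i) (poincareInv (mo i).1 (mo i).2 x)⟩ Φ)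 ≤ ENNReal.ofReal ε') ∧ supCkENorm {x : E4 | x 0 = τ ∧ (∀ j, r₀ j < Kerr.radius (a j) (poincareInv (mo j).1 (mo j).2 x)) ∧ ∀ j, R j - 1 ≤ Kerr.radius (a j) (poincareInv (mo j).1 (mo j).2 x)} k (𝒟.toSpacetime.deviationExtend (Minkowski.backgroundOn U) Φ) ≤ ENNReal.ofReal ε' ∧ (∀ x : ↥U, x.1 0 = τ → (∀ j, R j - 1 ≤ Kerr.radius (a j) (poincareInv (mo j).1 (mo j).2 x.1)) → 𝒟.timeOrientation.IsFutureDirected (mfderiv 𝓘(ℝ, E4) (𝓡 4) Φ x (E4.basisVector 0))) :=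
  fun _ _ _ _ _ _ _ _ _ 𝒟 N M a r₀ mo _ _ _ hε h ↦
    (show SlabAt _ 𝒟 N M a r₀ mo _ _ from h).mono hε

end Summit.FinalStateConjecture.FinalStateConjecture.Theorems.KerrnessPropagates.KerrBasinCapture

end
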